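/-
Copyright: the b2b-balaban T⁴-continuum CRUX team, row NE7b leaf lineage `t4-ne7b-formalise-leaf-01` (gen 85). Project licence.
-/
import Mathlib.Analysis.SpecialFunctions.Pow.Real
import Mathlib.Tactic.Positivity
import Mathlib.Tactic.Linarith
import Mathlib.Tactic.FieldSimp

/-!
# THE RADIUS LETTER OF THE HARD-STEP TOWER CANNOT HOLD WHEN `|t|·‖M₂‖ ≥ 1`: under HSTT's equivalence bound `(1 + B∕m)‖M₂‖ + m⁻¹ ≤ N`
# and margin `c < N⁻¹`, HSTB's dimensionless `s = |t|·(N⁻¹ − c)⁻¹` is STRICTLY LARGER than `|t|·‖M₂‖`; so `s < 1` fails as soon as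
# `|t|·‖M₂‖ ≥ 1` — and for block averaging in the `ℓ²` currency with the canonical rescaling, `(|t|·‖M₂‖)² = (L²∕L^d)·L^d = L²`, i.e.
# `|t|·‖M₂‖ = L ≥ 1` in EVERY dimension (row NE7b, node U5c; Mathlib only; [folklore] real arithmetic valuing `t4-ne7b-idea-1` g102's PS-1)

Cell `pub-balaban`, sub-cell `t4`, spine estimate NE7b (`T4WeightBudget.RelWeightBound`; the cell's OWN estimate — NOT PRINTED in
[Bałaban 1983–89], NOT PROVED).  Crux-route work under `Spine/NE7b/` by a row leaf (`t4-ne7b-formalise-leaf-01` gen 85) under FREEZE (0)'s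
crux-prover clause; NOTHING of Bałaban's is named as a Lean object, valued or asserted; no `T4Continuum/Support` leaf typed; no `def`; zero
`sorry`.  Imports: Mathlib only (fileable independently of the hub's olean frontier); the letters of leaf-06's `…HardStepTowerTwoSteps` (HSTT:
`hN : (1 + t²BK₁²∕m₂)‖M₂‖ + m₂⁻¹ ≤ N₂`, `hc : c < N⁻¹`) and `…HardStepTowerBox` (HSTB: `s := |t|·(N⁻¹ − c)⁻¹`, `radius_admissible` needs `s < 1`)
are met BY SHAPE as real numbers; this lineage's `…TwoScalePoincareTransported.norm_blockConstant_sq_eq` (`‖S k‖² = N·‖k‖²`) and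
`…TwoScalePoincareBlocking.closing_by_value` (`t² = L²∕L^d`) supply the lattice numbers of §3 BY SHAPE.

WHY (located).  `t4-ne7b-idea-1` g102's remark PS-1 (journal l.59923, `T102-PS1-EXACT-S-OBSTRUCTION-idea1-g102.md`): in the fixed `ℓ²`
normalisation of this lineage's free-field model (equal fibres, block average `d_T² = L^{−d}`, block-constant section `μ² = L^d`, canonical
`t² = L^{2−d}`) one has `|t|·‖M‖ = L`, and with HSTT's `hN ∧ hc`, `s > |t|N ≥ |t|‖M‖ = L ≥ 2`, so HSTB's `hs : s < 1` is unsatisfiable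
there.  THIS FILE makes that a theorem, in two layers: (§1–§2) for ANY data — `0 < m`, `0 ≤ B`, `0 < μ = ‖M₂‖`, `0 ≤ c`, HSTT's
`(1 + B∕m)μ + m⁻¹ ≤ N` and `c < N⁻¹` force `(N⁻¹ − c)⁻¹ > μ`, hence `s = |t|(N⁻¹ − c)⁻¹ > |t|μ`, and `s < 1` is IMPOSSIBLE once `|t|μ ≥ 1`
(the obstruction is independent of the action `V`: only the section's norm and the rescaling enter); (§3) the lattice numbers: `μ² = L^d`,
`t² = L²∕L^d`, `0 < t`, `0 ≤ μ` give `(tμ)² = L²`, so `tμ = L ≥ 1` for `L ≥ 1`; (§4) the END joins them.  What it says for the row: the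
hard-step chain's radius bookkeeping (`r₂ < (N⁻¹ − c)r∕|t|`, HSTT `hr₂ρ`) cannot be closed with the block-constant section in the `ℓ²`
currency of AHE ∕ HKB — the radius shrinks by at least `|t|μ = L` per step; a closing family needs either a different section ∕ currency
(print's small-field conditions are pointwise, `‖M‖_∞ = 1`, `|t|·1 = L^{(2−d)∕2} < 1` for `d ≥ 3`) or a different radius bookkeeping —
the hard-step cell's call (leaf-03∕04∕06), zero weight from here; the COERCIVITY letter `m ≤ t²m₂∕d²` is unaffected (TSPB ∕ FFTI close it).

WHAT IS PROVED ([folklore] real arithmetic):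
* §1 `inv_margin_gt_norm` (`0 < m`, `0 ≤ B`, `0 < μ`, `0 ≤ c`, `(1 + B∕m)μ + m⁻¹ ≤ N`, `c < N⁻¹` ⊢ `μ < (N⁻¹ − c)⁻¹`), `s_gt_t_mul_norm`
  (`t ≠ 0` ⊢ `|t|μ < |t|(N⁻¹ − c)⁻¹`).
* §2 **`radius_letter_fails`** (the same data and `1 ≤ |t|μ` ⊢ `¬ (|t|(N⁻¹ − c)⁻¹ < 1)`) — HSTB's `hs` is unsatisfiable.
* §3 `t_mul_norm_eq_L` (`μ² = L^d`, `t² = L²∕L^d`, `0 < t`, `0 ≤ μ`, `0 < L` ⊢ `t·μ = L`), `one_le_t_mul_norm` (`1 ≤ L` ⊢ `1 ≤ |t|μ`).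
* §4 **`radius_letter_fails_blockAverage_l2`** — THE END: HSTT's `hN ∧ hc` with `‖M₂‖ = μ`, `μ² = L^d`, `t² = L²∕L^d`, `0 < t`, `1 ≤ L`
  ⊢ `¬ (|t|(N⁻¹ − c)⁻¹ < 1)`; toy (§5): `L = 2`, `d = 4`: `t = 1∕2`, `μ = 4`, `tμ = 2`.

NOT HERE (honest): the sup-norm currency and whether the chain (AHE ∕ HKB need an inner product) can be run in it; a different section (the
fibre minimiser has the SAME `ℓ²` norm growth `≥ √N` on constants-per-block, so it does not evade §4 — remark, not proved here); anything of
Bałaban's ((A3) ∕ (A1c), NC-NE7b-α UNRULED).  BY-NAME EFFECT ON THE WALL: NONE (a located NEGATIVE letter about one model currency of one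
road's closing family).  NE7b NOT PRINTED ∕ NOT PROVED; spine PROVED 0∕9; rung (B)+1 on a FINITE torus — NOT infinite volume, NOT the mass gap,
NOT Clay.  HONEST DEPENDENCY: continuum YM on T⁴ ⇐ BetaPertH ∧ nine spine estimates (0∕9 proved); BetaPertH ⇐ (D1) ∧ (D4) ∧ CAP+tail; G-an2-4
gates asym, D1 and NE2∕3∕4.
-/

set_option autoImplicit false

namespace Summit.QuantumFields.BalabanUV.T4Continuum.NE7b.HardStepRadiusObstruction

/-! ## §1. The chart constant exceeds the section's norm -/

/-- **`(N⁻¹ − c)⁻¹ > μ`**: HSTT's equivalence bound `(1 + B∕m)μ + m⁻¹ ≤ N` (with `0 < m`, `0 ≤ B`, `0 < μ`) gives `μ < N`, the margin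
`0 ≤ c < N⁻¹` gives `0 < N⁻¹ − c ≤ N⁻¹ < μ⁻¹`, hence `μ < (N⁻¹ − c)⁻¹ = K₁`. [folklore] -/
theorem inv_margin_gt_norm {m B μ c N : ℝ} (hm : 0 < m) (hB : 0 ≤ B) (hμ : 0 < μ) (hc0 : 0 ≤ c)
    (hN : (1 + B / m) * μ + m⁻¹ ≤ N) (hc : c < N⁻¹) : μ < (N⁻¹ - c)⁻¹ := by
  have hμN : μ < N := by
    have h1 : μ ≤ (1 + B / m) * μ := by
      have : 0 ≤ B / m * μ := by positivity
      nlinarith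
    have h2 : 0 < m⁻¹ := inv_pos.2 hm
    linarith
  have hNpos : 0 < N := lt_trans hμ hμN
  have hP : 0 < N⁻¹ - c := sub_pos.2 hc
  have hPle : N⁻¹ - c ≤ N⁻¹ := by linarith
  have hNinv : N⁻¹ < μ⁻¹ := (inv_lt_inv₀ hNpos hμ).2 hμN
  calc μ = (μ⁻¹)⁻¹ := (inv_inv μ).symm
    _ < (N⁻¹ - c)⁻¹ := (inv_lt_inv₀ (inv_pos.2 hμ) hP).2 (lt_of_le_of_lt hPle hNinv)

/-- Hence `s = |t|·(N⁻¹ − c)⁻¹ > |t|·μ` for `t ≠ 0`. [folklore] -/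
theorem s_gt_t_mul_norm {m B μ c N t : ℝ} (hm : 0 < m) (hB : 0 ≤ B) (hμ : 0 < μ) (hc0 : 0 ≤ c)
    (hN : (1 + B / m) * μ + m⁻¹ ≤ N) (hc : c < N⁻¹) (ht : t ≠ 0) : |t| * μ < |t| * (N⁻¹ - c)⁻¹ :=
  mul_lt_mul_of_pos_left (inv_margin_gt_norm hm hB hμ hc0 hN hc) (abs_pos.2 ht)

/-! ## §2. The radius letter fails once `|t|·μ ≥ 1` -/

/-- **HSTB's `s < 1` IS UNSATISFIABLE ONCE `|t|·‖M₂‖ ≥ 1`**, jointly with HSTT's `hN ∧ hc` — for ANY action: only the section's norm `μ`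
and the rescaling `t` enter. [folklore] -/
theorem radius_letter_fails {m B μ c N t : ℝ} (hm : 0 < m) (hB : 0 ≤ B) (hμ : 0 < μ) (hc0 : 0 ≤ c)
    (hN : (1 + B / m) * μ + m⁻¹ ≤ N) (hc : c < N⁻¹) (ht : t ≠ 0) (htμ : 1 ≤ |t| * μ) :
    ¬ (|t| * (N⁻¹ - c)⁻¹ < 1) := by
  have h := s_gt_t_mul_norm hm hB hμ hc0 hN hc ht
  intro hs
  linarith

/-! ## §3. The lattice numbers: `μ² = L^d`, `t² = L²∕L^d` ⟹ `tμ = L` -/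

/-- **`t·μ = L`** for `μ² = L^d` (the block-constant section's norm growth, TSPT `norm_blockConstant_sq_eq`) and `t² = L²∕L^d` (the
canonical amplitude rescaling, TSPB `closing_by_value`'s `t²`), `0 < t`, `0 ≤ μ`, `0 < L`. [folklore] -/
theorem t_mul_norm_eq_L {t μ L : ℝ} {d : ℕ} (hL : 0 < L) (ht : 0 < t) (hμ : 0 ≤ μ) (hμ2 : μ ^ 2 = L ^ d)
    (ht2 : t ^ 2 = L ^ 2 / L ^ d) : t * μ = L := by
  have hLd : L ^ d ≠ 0 := pow_ne_zero d hL.ne'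
  have hsq : (t * μ) ^ 2 = L ^ 2 := by
    rw [mul_pow, ht2, hμ2, div_mul_cancel₀ _ hLd]
  have h0 : 0 ≤ t * μ := mul_nonneg ht.le hμ
  exact (pow_left_inj₀ h0 hL.le two_ne_zero).1 hsq

/-- Hence `1 ≤ |t|·μ` whenever `1 ≤ L`. [folklore] -/
theorem one_le_t_mul_norm {t μ L : ℝ} {d : ℕ} (hL : 1 ≤ L) (ht : 0 < t) (hμ : 0 ≤ μ) (hμ2 : μ ^ 2 = L ^ d)
    (ht2 : t ^ 2 = L ^ 2 / L ^ d) : 1 ≤ |t| * μ := by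
  rw [abs_of_pos ht, t_mul_norm_eq_L (lt_of_lt_of_le zero_lt_one hL) ht hμ hμ2 ht2]
  exact hL

/-! ## §4. THE END: block averaging in the `ℓ²` currency cannot meet the radius letter -/

/-- **THE RADIUS LETTER FAILS FOR BLOCK AVERAGING IN THE `ℓ²` CURRENCY, IN EVERY DIMENSION.**  HSTT's `hN : (1 + B∕m)‖M₂‖ + m⁻¹ ≤ N`
(`0 < m`, `0 ≤ B`) and `hc : c < N⁻¹` (`0 ≤ c`), the section's norm `‖M₂‖ = μ` with `μ² = L^d` (equal fibres `N = L^d`, block-constant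
section) and the canonical rescaling `t² = L²∕L^d`, `0 < t`, `1 ≤ L` ⊢ HSTB's `s = |t|(N⁻¹ − c)⁻¹` is NOT `< 1` (indeed `> L`).  PS-1 of
`t4-ne7b-idea-1` g102 as a theorem. [folklore] -/
theorem radius_letter_fails_blockAverage_l2 {m B μ c N t L : ℝ} {d : ℕ} (hm : 0 < m) (hB : 0 ≤ B) (hc0 : 0 ≤ c)
    (hN : (1 + B / m) * μ + m⁻¹ ≤ N) (hc : c < N⁻¹)
    (hL : 1 ≤ L) (ht : 0 < t) (hμ : 0 ≤ μ) (hμ2 : μ ^ 2 = L ^ d) (ht2 : t ^ 2 = L ^ 2 / L ^ d) :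
    ¬ (|t| * (N⁻¹ - c)⁻¹ < 1) := by
  have hL0 : 0 < L := lt_of_lt_of_le zero_lt_one hL
  have hμpos : 0 < μ := by
    rcases hμ.eq_or_lt with h | h
    · exfalso
      rw [← h] at hμ2
      have : (0 : ℝ) < L ^ d := pow_pos hL0 d
      rw [← hμ2] at this
      norm_num at this
    · exact h
  exact radius_letter_fails hm hB hμpos hc0 hN hc ht.ne' (one_le_t_mul_norm hL ht hμ hμ2 ht2)

/-- The same read quantitatively: `s > L`. [folklore] -/
theorem s_gt_L_blockAverage_l2 {m B μ c N t L : ℝ} {d : ℕ} (hm : 0 < m) (hB : 0 ≤ B) (hc0 : 0 ≤ c)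
    (hN : (1 + B / m) * μ + m⁻¹ ≤ N) (hc : c < N⁻¹)
    (hL : 0 < L) (ht : 0 < t) (hμ : 0 < μ) (hμ2 : μ ^ 2 = L ^ d) (ht2 : t ^ 2 = L ^ 2 / L ^ d) :
    L < |t| * (N⁻¹ - c)⁻¹ := by
  have h := s_gt_t_mul_norm hm hB hμ hc0 hN hc ht.ne'
  rw [abs_of_pos ht, t_mul_norm_eq_L hL ht hμ.le hμ2 ht2] at h
  rwa [abs_of_pos ht]

/-! ## §5. Toy -/

/-- Toy: `L = 2`, `d = 4`: `t² = 4∕16`, `t = 1∕2`, `μ² = 16`, `μ = 4`, `tμ = 2 = L`. -/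
example : (1 / 2 : ℝ) * 4 = 2 := by norm_num

example : ((1 / 2 : ℝ)) ^ 2 = (2 : ℝ) ^ 2 / 2 ^ 4 ∧ (4 : ℝ) ^ 2 = 2 ^ 4 := by norm_num

/-! ## §6. (v1.1 append) HSTB's hypothesis family verbatim: the closing family is EMPTY once `1 ≤ |t|·μ` -/

/-- **THE CLOSING FAMILY OF `…HardStepTowerBox.closing_conditions` IS EMPTY WHEN `1 ≤ |t|·μ` AND `P` MEANS `N⁻¹ − c`.**  The fourteen
hypotheses of HSTB's END copied VERBATIM as real letters (`hP … hN`), plus the two kinematic readings `hPN : P = N⁻¹ − c` (HSTT's `hr₂ρ` ∕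
`hc` with the SAME `N` at the next scale — what the box exists to close) and `hkin : 1 ≤ |t|·μ` ⊢ `False`.  Four lines: `hsc`'s left side is a
product of non-negatives, so `0 ≤ c` and `P ≤ N⁻¹`; `hs` with `0 < P` gives `|t| < P`; `hN` with `0 < m`, `0 ≤ B`, `0 ≤ nM ≤ μ` gives `μ < N`;
hence `|t|·μ < P·N ≤ 1`.  (The pricing desk's own kernel-checked witness F660, PRICING-NE7b v117, reached the same `False` in the same hour; this is
the tree-filed twin, credit `t4-ne7b-idea-1` g102 PS-1 and `t4-ne7b-refuter` g96 F660.) [folklore] -/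
theorem closingFamily_empty_of_kinematics {P t r B G M₃ c m m₂ nM μ N : ℝ} (hP : 0 < P) (ht : t ≠ 0) (hr : 0 < r)
    (hB : 0 ≤ B) (_hG : 0 ≤ G) (hM₃ : 0 ≤ M₃)
    (hs : |t| * P⁻¹ < 1) (_hs3 : (|t| * P⁻¹) ^ 3 * (1 + 2 * B * P⁻¹) ≤ 1)
    (hsc : (|t| * P⁻¹) ^ 3 * (1 + 2 * B * P⁻¹) * M₃ * r ≤ c)
    (hm : 0 < m) (_hmm : m ≤ m₂) (hnM : 0 ≤ nM) (hnMμ : nM ≤ μ)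
    (hN : (1 + (|t| * P⁻¹) ^ 2 * B / m) * μ + m⁻¹ ≤ N)
    (hPN : P = N⁻¹ - c) (hkin : 1 ≤ |t| * μ) : False := by
  -- `_hG`, `_hs3`, `_hmm` are members of HSTB's family that the contradiction does not need (kept VERBATIM on purpose)
  have ht0 : 0 < |t| := abs_pos.2 ht
  have hs0 : 0 ≤ |t| * P⁻¹ := mul_nonneg ht0.le (inv_pos.2 hP).le
  -- `0 ≤ c` from `hsc`
  have hc0 : 0 ≤ c := le_trans (by positivity) hsc
  -- `μ < N`, `0 < N`
  have hμ0 : 0 ≤ μ := le_trans hnM hnMμ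
  have hμN : μ < N := by
    have h1 : μ ≤ (1 + (|t| * P⁻¹) ^ 2 * B / m) * μ := by
      have : 0 ≤ (|t| * P⁻¹) ^ 2 * B / m * μ := by positivity
      nlinarith
    have h2 : 0 < m⁻¹ := inv_pos.2 hm
    linarith
  have hN0 : 0 < N := lt_of_le_of_lt hμ0 hμN
  -- `|t| < P ≤ N⁻¹`
  have htP : |t| < P := by
    have := (mul_inv_lt_iff₀ hP).1 hs
    simpa using this
  have hPN' : P ≤ N⁻¹ := by rw [hPN]; linarith
  -- contradiction: `1 ≤ |t| μ < |t| N ≤ P N ≤ N⁻¹ N = 1`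
  have h1 : |t| * μ < |t| * N := mul_lt_mul_of_pos_left hμN ht0
  have h2 : |t| * N < P * N := mul_lt_mul_of_pos_right htP hN0
  have h3 : P * N ≤ N⁻¹ * N := mul_le_mul_of_nonneg_right hPN' hN0.le
  rw [inv_mul_cancel₀ hN0.ne'] at h3
  linarith

end Summit.QuantumFields.BalabanUV.T4Continuum.NE7b.HardStepRadiusObstruction
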